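import Summits.KontsevichZagierPeriods.KontsevichZagierPeriods.Theorems.ValuedFieldSpecialisationCTConstructionSplitTyped
import Summits.KontsevichZagierPeriods.KontsevichZagierPeriods.Theorems.ValuedFieldSpecialisationClassLevelExpansionFibreDimOneRpow

/-!
# Route ValuedFieldSpecialisation — crux `CTConstruction`: recasting the sheared blow-up

Helper toward crux stmt-KontsevichZagierPeriods-3495 (`CTConstruction`), line `registered`,
reshape r4 (blow-up elimination of the log block), stub `stub_blowup_recast`. An **elementary
divergent product** `P = P(p, q, B, d, r)` (`0 < q`) has coordinates `(s, u, y, w)`, domain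
`0 < s < 1`, `0 < u`, `u ^ q s ^ p < 1`, `s ≤ y_j ≤ 1`, `w ∈ r.domain`, and integrand
`∏ y_j⁻¹ · r.integrand w`. Its **sheared blow-up** `R` (coordinates `z = (σ, s', u, t, w)`, the
point fed to `P` being `(σ s', u, t, w)`) has domain `0 < σ < 1`, `0 < s' < 1`, `0 < u`,
`u ^ q (σ s') ^ p < 1`, `σ s' ≤ t_j ≤ 1`, `w ∈ r.domain`, and integrand `s' · ∏ t_j⁻¹ · r(w)`. The
only non-elementary feature is the `u`-bound `u < (σ s') ^ (-p/q)`; the **rpow-shear**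
`v = u · s' ^ (p/q)` — the map `Φ z = update z 2 (z 2 * (z 1) ^ (p/q))`, which fixes `z 0` and
`z 1` — turns it into `v ^ q σ ^ p < 1` and divides the integrand by the Jacobian `s' ^ (p/q)`,
giving the **typed family `F` of type `(1, 1)`**: domain `0 < σ < 1`, `0 < s' < 1`, `0 < v`,
`v ^ q σ ^ p < 1`, `σ ^ 1 s' ^ 1 ≤ t_j ≤ 1`, `w ∈ r.domain`, integrand
`s' ^ (1 - p/q) · ∏ t_j⁻¹ · r(w)`.

`stub_blowup_recast`: `F` EXISTS and `[R] - [F] ∈ KZ.fibredRelations`. We treat the rpow-shear of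
an arbitrary coordinate `i` by a real power of a coordinate `k < i`: it has a lower-triangular
derivative of determinant `(z k) ^ e` (`rpowShear_data`, pattern of `shear_data` of the companion
file `…CTConstructionSplitTyped.lean`), it is `ℚ`-semialgebraic for a rational exponent
(`isSemialgebraicFunOn_rpow_coord`) and injective where `0 < z k`, so a representation `R'` with
`0 < z k` on its domain and `R'.integrand z = g (Φ z) * (z k) ^ (p/q)` is fibred-equivalent to the
representation on `Φ '' R'.domain` with integrand `g`, CONSTRUCTED by transport of structure
(image of a semialgebraic set under a semialgebraic map,
`MeasureTheory.integrableOn_image_iff_integrableOn_abs_det_fderiv_smul`, and the fibred change of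
variables `KZ.of_sub_of_mem_fibredChangeOfVariablesRel`).

Sources: M. Kontsevich, D. Zagier, *Periods* (2001), §1.2 (rule (2)); J. Bochnak, M. Coste,
M.-F. Roy, *Real Algebraic Geometry* (1998), §2.2 (Prop. 2.2.6–2.2.7, semialgebraic maps and
their images). No new definitions.
-/

noncomputable section

namespace Summit.KontsevichZagierPeriods.ValuedFieldSpecialisation

open MeasureTheory Set Filter
open scoped Topology
open Literature.NumberTheory.Transcendental Literature.NumberTheory.Transcendental.KZ
open Literature.ModelTheory.ExponentialFields (IsSemialgebraic)

/-! ## The rpow-shear `z ↦ update z i (z i * (z k) ^ e)` -/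

/-- **Derivative and Jacobian of the rpow-shear.** For indices `k < i` and a real exponent `e`,
the map `Φ z = update z i (z i * (z k) ^ e)` has, at every point `x` with `0 < x k`, the derivative
`v ↦ v + (x i * (e * (x k) ^ (e - 1)) * v k + (x k) ^ e * v i - v i) • e_i`, a lower-triangular
endomorphism (the identity except in row `i`, whose diagonal entry is `(x k) ^ e` and whose entry
in column `k` is `x i * e * (x k) ^ (e - 1)`) of determinant `(x k) ^ e`
(`Matrix.det_of_lowerTriangular`; pattern of `shear_data`). [folklore] -/
theorem rpowShear_data {N : ℕ} (i k : Fin N) (hki : k < i) (e : ℝ) :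
    ∃ Φ' : (Fin N → ℝ) → (Fin N → ℝ) →L[ℝ] (Fin N → ℝ),
      (∀ x : Fin N → ℝ, 0 < x k →
        HasFDerivAt (fun z : Fin N → ℝ => Function.update z i (z i * z k ^ e)) (Φ' x) x) ∧
        ∀ x, (Φ' x).det = x k ^ e := by
  let π : Fin N → (Fin N → ℝ) →L[ℝ] ℝ := fun l =>
    ContinuousLinearMap.proj (R := ℝ) (φ := fun _ : Fin N => ℝ) l
  let Φ' : (Fin N → ℝ) → (Fin N → ℝ) →L[ℝ] (Fin N → ℝ) := fun x =>
    ContinuousLinearMap.id ℝ (Fin N → ℝ) +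
      ((x i • ((e * x k ^ (e - 1)) • π k) + (x k ^ e) • π i) - π i).smulRight (Pi.single i 1)
  -- the matrix entries `Φ' x e_b a`
  have hΦ' : ∀ x (a b : Fin N), LinearMap.toMatrix'
      ((Φ' x : (Fin N → ℝ) →L[ℝ] (Fin N → ℝ)) : (Fin N → ℝ) →ₗ[ℝ] (Fin N → ℝ)) a b =
      (Pi.single b 1 : Fin N → ℝ) a +
      ((x i * ((e * x k ^ (e - 1)) * (Pi.single b 1 : Fin N → ℝ) k) +
        x k ^ e * (Pi.single b 1 : Fin N → ℝ) i) -
        (Pi.single b 1 : Fin N → ℝ) i) * (Pi.single i 1 : Fin N → ℝ) a :=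
    fun x a b => rfl
  have hik : i ≠ k := hki.ne'
  refine ⟨Φ', fun x hxk => ?_, fun x => ?_⟩
  · have hfun : (fun z : Fin N → ℝ => Function.update z i (z i * z k ^ e)) =
        fun z => z + (z i * z k ^ e - z i) • (Pi.single i 1 : Fin N → ℝ) := by
      funext z
      ext a
      rcases eq_or_ne a i with rfl | ha
      · simp
      · simp [ha]
    rw [hfun]
    exact (hasFDerivAt_id x).add ((((hasFDerivAt_apply i x).mul
      ((hasFDerivAt_apply k x).rpow_const (Or.inl hxk.ne'))).sub
      (hasFDerivAt_apply i x)).smul_const _)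
  · -- lower triangular, diagonal `(1, …, (x k) ^ e, …, 1)`
    rw [ContinuousLinearMap.det, ← LinearMap.det_toMatrix', Matrix.det_of_lowerTriangular _ ?_]
    · have hdiag : ∀ a, LinearMap.toMatrix' ((Φ' x : (Fin N → ℝ) →L[ℝ] (Fin N → ℝ)) :
          (Fin N → ℝ) →ₗ[ℝ] (Fin N → ℝ)) a a = if a = i then x k ^ e else 1 := by
        intro a
        rw [hΦ', Pi.single_eq_same]
        rcases eq_or_ne a i with rfl | ha
        · rw [if_pos rfl, Pi.single_eq_same, Pi.single_eq_of_ne hik.symm]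
          ring
        · rw [if_neg ha, Pi.single_eq_of_ne ha, mul_zero, add_zero]
      simp [hdiag]
    · intro a b hab
      have hab' : a < b := hab
      rw [hΦ', Pi.single_eq_of_ne (ne_of_lt hab')]
      rcases eq_or_ne a i with rfl | ha
      · have hkb : k ≠ b := (hki.trans hab').ne
        simp only [Pi.single_eq_of_ne (ne_of_lt hab'), Pi.single_eq_of_ne hkb, mul_zero,
          add_zero, sub_zero, zero_mul]
      · rw [Pi.single_eq_of_ne ha, mul_zero, add_zero]

/-- The rpow-shear `Φ z = update z i (z i * (z k) ^ (p/q))` (`0 < q`) is a `ℚ`-semialgebraic map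
on every `ℚ`-semialgebraic set on which `0 < z k`: its coordinates are coordinate functions and
the product of a coordinate with the semialgebraic function `(z k) ^ (p/q)`
(`isSemialgebraicFunOn_rpow_coord`, `IsSemialgebraicMapOn.of_forall`).
[Bochnak–Coste–Roy 1998, §2.2] [folklore] -/
theorem isSemialgebraicMapOn_rpowShear {N : ℕ} (i k : Fin N) {p q : ℕ} (hq : 0 < q)
    {σ : Set (Fin N → ℝ)} (hσ : IsSemialgebraic ℚ σ) (hpos : ∀ z ∈ σ, 0 < z k) :
    IsSemialgebraicMapOn ℚ σ
      (fun z : Fin N → ℝ => Function.update z i (z i * z k ^ ((p : ℝ) / q))) := by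
  refine IsSemialgebraicMapOn.of_forall hσ fun j => ?_
  rcases eq_or_ne j i with rfl | hj
  · refine (IsSemialgebraicFunOn.mul_holds (isSemialgebraicFunOn_apply hσ j)
      (isSemialgebraicFunOn_rpow_coord hσ k hpos (p := p) hq)).congr fun z _ => ?_
    rw [Pi.mul_apply, Function.update_self]
  · exact (isSemialgebraicFunOn_apply hσ j).congr fun z _ => (Function.update_of_ne hj _ _).symm

/-- **Transport through the rpow-shear onto its image.** Let `R'` be a representation in
dimension `N + 1` on whose domain `0 < z k`, let `k < i`, `i ≠ 0`, `0 < q`, and let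
`Φ z = update z i (z i * (z k) ^ (p/q))` be the rpow-shear, `E = Φ '' R'.domain` its image. If
`g` is `ℚ`-semialgebraic on `E` and `R'.integrand z = g (Φ z) * (z k) ^ (p/q)` on `R'.domain`,
then `E` carries a representation `R''` with integrand `g`, and `[R'] - [R''] ∈ fibredRelations`:
`Φ` is a fibred change of variables from `R'` onto `R''` (semialgebraic, injective on
`{0 < z k}`, `Φ z 0 = z 0`, Jacobian `(z k) ^ (p/q) > 0`, `rpowShear_data`), `E` is semialgebraic
as the image of a semialgebraic map, and `g` is integrable on `E` by the change-of-variables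
formula. [Kontsevich–Zagier 2001, §1.2 rule (2); Bochnak–Coste–Roy 1998, Prop. 2.2.7]
[folklore] -/
theorem exists_rep_of_sub_mem_fibredRelations_rpowShear {N : ℕ} (i k : Fin (N + 1))
    (hki : k < i) (hi0 : i ≠ 0) {p q : ℕ} (hq : 0 < q) (R' : IntegralRep (N + 1))
    (hpos : ∀ z ∈ R'.domain, 0 < z k) {E : Set (Fin (N + 1) → ℝ)}
    (hE : (fun z : Fin (N + 1) → ℝ => Function.update z i (z i * z k ^ ((p : ℝ) / q))) ''
      R'.domain = E)
    (g : (Fin (N + 1) → ℝ) → ℝ) (hg : IsSemialgebraicFunOn ℚ E g)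
    (hfg : ∀ z ∈ R'.domain, R'.integrand z =
      g (Function.update z i (z i * z k ^ ((p : ℝ) / q))) * z k ^ ((p : ℝ) / q)) :
    ∃ R'' : IntegralRep (N + 1), R''.domain = E ∧ R''.integrand = g ∧
      of R' - of R'' ∈ fibredRelations := by
  obtain ⟨Φ', hderiv, hdet⟩ := rpowShear_data i k hki ((p : ℝ) / q)
  have hsa := R'.isSemialgebraic_domain
  have hmeas : MeasurableSet R'.domain := IsSemialgebraic.measurableSet_holds hsa
  have hΦ := isSemialgebraicMapOn_rpowShear i k (p := p) hq hsa hpos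
  have hderivW : ∀ x ∈ R'.domain, HasFDerivWithinAt
      (fun z : Fin (N + 1) → ℝ => Function.update z i (z i * z k ^ ((p : ℝ) / q))) (Φ' x)
        R'.domain x :=
    fun x hx => (hderiv x (hpos x hx)).hasFDerivWithinAt
  have hik : i ≠ k := hki.ne'
  -- `Φ` is injective on `R'.domain`
  have hinj : InjOn (fun z : Fin (N + 1) → ℝ => Function.update z i (z i * z k ^ ((p : ℝ) / q)))
      R'.domain := by
    intro z₁ _ z₂ hz₂ h
    have hk' : z₁ k = z₂ k := by
      simpa only [Function.update_of_ne hik.symm] using congrFun h k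
    refine funext fun a => ?_
    rcases eq_or_ne a i with rfl | ha
    · refine mul_right_cancel₀ (Real.rpow_pos_of_pos (hpos _ hz₂) ((p : ℝ) / q)).ne' ?_
      simpa only [Function.update_self, hk'] using congrFun h a
    · simpa only [Function.update_of_ne ha] using congrFun h a
  -- the image is semialgebraic, and `g` is integrable on it
  have hEsa : IsSemialgebraic ℚ E :=
    hE ▸ IsSemialgebraicMapOn.isSemialgebraic_image_holds hΦ Subset.rfl hsa
  have hint : IntegrableOn g E volume := by
    rw [← hE]
    refine (integrableOn_image_iff_integrableOn_abs_det_fderiv_smul volume hmeas hderivW hinj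
      g).mpr (R'.integrableOn.congr_fun (fun z hz => ?_) hmeas)
    rw [smul_eq_mul, hdet, abs_of_pos (Real.rpow_pos_of_pos (hpos z hz) _), mul_comm]
    exact hfg z hz
  refine ⟨⟨E, g, hEsa, hg, hint⟩, rfl, rfl, ?_⟩
  -- `Φ` is a fibred change of variables from `R'` onto `R''`
  exact mem_fibredRelations_of_mem_fibredChangeOfVariablesRel
    (of_sub_of_mem_fibredChangeOfVariablesRel (r' := ⟨E, g, hEsa, hg, hint⟩)
      (Φ := fun z : Fin (N + 1) → ℝ => Function.update z i (z i * z k ^ ((p : ℝ) / q)))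
      (Φ' := Φ') hΦ hderivW hinj hE.symm
      (fun x hx => by
        dsimp only
        rw [hdet, abs_of_pos (Real.rpow_pos_of_pos (hpos x hx) _)]
        exact hfg x hx)
      (fun x _ => Function.update_of_ne hi0.symm _ _))

/-! ## Coordinates of the typed family of type `(1, 1)` -/

/-- Reassembling a point of `ℝᵇ⁺ᵈ⁺³` from its coordinates `(σ, s', v, t, w)`. [folklore] -/
theorem vecCons_vecCons_vecCons_append_eq {b d : ℕ} (z : Fin (b + d + 1 + 1 + 1) → ℝ) :
    Matrix.vecCons (z 0) (Matrix.vecCons (z 1) (Matrix.vecCons (z 2) (Fin.append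
      (fun j : Fin b => z (Fin.castAdd d j).succ.succ.succ)
      (fun l : Fin d => z (Fin.natAdd b l).succ.succ.succ)))) = z := by
  funext i
  refine Fin.cases ?_ (fun i' => Fin.cases ?_ (fun i'' => Fin.cases ?_ (fun k => ?_) i'') i') i
  · simp
  · simp
  · simp
  · simp only [Matrix.cons_val_succ]
    refine Fin.addCases (fun j => ?_) (fun l => ?_) k
    · simp
    · simp

/-- The `∃`-description of the domain of the typed family of type `(1, 1)` (lower bounds
`σ ^ 1 * s' ^ 1 ≤ t j`) agrees with its coordinate description (pattern of `typedDomain_eq`).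
[folklore] -/
theorem blowupTypedDomain_eq {d : ℕ} (q p B : ℕ) (ρ : IntegralRep d) :
    {z : Fin (B + d + 1 + 1 + 1) → ℝ | ∃ (σ s' v : ℝ) (t : Fin B → ℝ) (w : Fin d → ℝ),
      z = Matrix.vecCons σ (Matrix.vecCons s' (Matrix.vecCons v (Fin.append t w))) ∧ 0 < σ ∧
        σ < 1 ∧ 0 < s' ∧ s' < 1 ∧ 0 < v ∧ v ^ q * σ ^ p < 1 ∧
        (∀ j, σ ^ (1 : ℕ) * s' ^ (1 : ℕ) ≤ t j ∧ t j ≤ 1) ∧ w ∈ ρ.domain} =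
    {z | 0 < z 0 ∧ z 0 < 1 ∧ 0 < z 1 ∧ z 1 < 1 ∧ 0 < z 2 ∧ z 2 ^ q * z 0 ^ p < 1 ∧
      (∀ j : Fin B, z 0 * z 1 ≤ z (Fin.castAdd d j).succ.succ.succ ∧
        z (Fin.castAdd d j).succ.succ.succ ≤ 1) ∧
      (fun l : Fin d => z (Fin.natAdd B l).succ.succ.succ) ∈ ρ.domain} := by
  ext z
  simp only [mem_setOf_eq, pow_one]
  constructor
  · rintro ⟨σ, s', v, t, w, rfl, hσ, hσ1, hs, hs1, hv, hvq, ht, hw⟩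
    refine ⟨by simpa using hσ, by simpa using hσ1, by simpa using hs, by simpa using hs1,
      by simpa using hv, by simpa using hvq, fun j => by simpa using ht j, by simpa using hw⟩
  · rintro ⟨hσ, hσ1, hs, hs1, hv, hvq, ht, hw⟩
    exact ⟨z 0, z 1, z 2, _, _, (vecCons_vecCons_vecCons_append_eq z).symm, hσ, hσ1, hs, hs1,
      hv, hvq, ht, hw⟩

/-! ## The stub -/

/-- **Stub `stub_blowup_recast` (the sheared blow-up of an elementary product is the typed
family of type `(1, 1)`).** For an elementary divergent product `P = P(p, q, B, d, r)` (`0 < q`)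
and its sheared blow-up `R` (domain `{0 < σ < 1, 0 < s' < 1, (σ s', u, t, w) ∈ P.domain}`,
integrand `s' · P.integrand (σ s', u, t, w)`), the typed family `F` — domain `0 < σ < 1`,
`0 < s' < 1`, `0 < v`, `v ^ q σ ^ p < 1`, `σ ^ 1 s' ^ 1 ≤ t_j ≤ 1`, `w ∈ r.domain`, integrand
`s' ^ (1 - p/q) · ∏ t_j⁻¹ · r(w)` — exists and `[R] - [F] ∈ KZ.fibredRelations`: the rpow-shear
`v = u · s' ^ (p/q)` of the coordinate `2` (`Φ z = update z 2 (z 2 * (z 1) ^ (p/q))`, fixing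
`z 0` and `z 1`, Jacobian `s' ^ (p/q)`) maps `R.domain` onto `F.domain` (because
`(u s' ^ (p/q)) ^ q σ ^ p = u ^ q (σ s') ^ p`), and
`s' · ∏ t_j⁻¹ · r(w) = (s' ^ (1 - p/q) · ∏ t_j⁻¹ · r(w)) · s' ^ (p/q)`
(`exists_rep_of_sub_mem_fibredRelations_rpowShear`). [Kontsevich–Zagier 2001, §1.2 rule (2)]
[folklore] -/
theorem stub_blowup_recast : ∀ (p q B d : ℕ) (r : Literature.NumberTheory.Transcendental.KZ.IntegralRep d) (P : Literature.NumberTheory.Transcendental.KZ.IntegralRep (B + d + 1 + 1)) (R : Literature.NumberTheory.Transcendental.KZ.IntegralRep (B + d + 1 + 1 + 1)), 0 < q → P.domain = {z | ∃ (s u : ℝ) (y : Fin B → ℝ) (w : Fin d → ℝ), z = Matrix.vecCons s (Matrix.vecCons u (Fin.append y w)) ∧ 0 < s ∧ s < 1 ∧ 0 < u ∧ u ^ q * s ^ p < 1 ∧ (∀ j, s ≤ y j ∧ y j ≤ 1) ∧ w ∈ r.domain} → P.integrand = (fun z => (∏ j : Fin B, (z (Fin.castAdd d j).succ.succ)⁻¹)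 * r.integrand (fun l : Fin d => z (Fin.natAdd B l).succ.succ)) → R.domain = {z | 0 < z 0 ∧ z 0 < 1 ∧ 0 < z 1 ∧ z 1 < 1 ∧ (fun i : Fin (B + d + 1 + 1) => (Function.update z 1 (z 1 * z 0) i.succ : ℝ)) ∈ P.domain} → R.integrand = (fun z => z 1 * P.integrand (fun i : Fin (B + d + 1 + 1) => (Function.update z 1 (z 1 * z 0) i.succ : ℝ))) → ∃ F : Literature.NumberTheory.Transcendental.KZ.IntegralRep (B + d + 1 + 1 + 1), F.domain = {z | ∃ (σ s' v : ℝ) (t : Fin B → ℝ) (w : Fin d → ℝ), z = Matrix.vecCons σ (Matrix.vecCons s' (Matrix.vecCons v (Fin.append t w))) ∧ 0 < σ ∧ σ < 1 ∧ 0 < s' ∧ s' < 1 ∧ 0 < v ∧ v ^ q * σ ^ p < 1 ∧ (∀ j, σ ^ (1 : ℕ) * s' ^ (1 : ℕ) ≤ t j ∧ t j ≤ 1) ∧ w ∈ r.domain} ∧ F.integrand = (fun z => z 1 ^ ((1 - (p : ℚ) / q : ℚ) : ℝ) * ((∏ j : Fin B, (z (Fin.castAdd d j).succ.succ.succ)⁻¹)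 * r.integrand (fun l : Fin d => z (Fin.natAdd B l).succ.succ.succ))) ∧ Literature.NumberTheory.Transcendental.KZ.of R - Literature.NumberTheory.Transcendental.KZ.of F ∈ Literature.NumberTheory.Transcendental.KZ.fibredRelations := by
  intro p q B d r P R hq hPd hPi hRd hRi
  -- index bookkeeping in `Fin (B + d + 3)`
  have h3 : 2 < B + d + 1 + 1 + 1 := by omega
  have h20 : (2 : Fin (B + d + 1 + 1 + 1)) ≠ 0 := by simp [Fin.ext_iff, Nat.mod_eq_of_lt h3]
  have h21 : (2 : Fin (B + d + 1 + 1 + 1)) ≠ 1 := by simp [Fin.ext_iff, Nat.mod_eq_of_lt h3]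
  have h12 : (1 : Fin (B + d + 1 + 1 + 1)) < 2 := by simp [Fin.lt_def, Nat.mod_eq_of_lt h3]
  have hk1 : ∀ k : Fin (B + d), k.succ.succ.succ ≠ (1 : Fin (B + d + 1 + 1 + 1)) := fun k =>
    succ_succ_ne_one k.succ
  have hk2 : ∀ k : Fin (B + d), k.succ.succ.succ ≠ (2 : Fin (B + d + 1 + 1 + 1)) := fun k => by
    simp [Fin.ext_iff, Nat.mod_eq_of_lt h3]
  -- `(y ^ (p/q)) ^ q = y ^ p`
  have hpow : ∀ {y : ℝ}, 0 < y → (y ^ ((p : ℝ) / q)) ^ q = y ^ p := fun hy =>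
    ((eq_rpow_div_iff hy hq).mp rfl).2
  -- the domain of `R` in coordinates
  have hRmem : ∀ z : Fin (B + d + 1 + 1 + 1) → ℝ, z ∈ R.domain ↔ 0 < z 0 ∧ z 0 < 1 ∧ 0 < z 1 ∧
      z 1 < 1 ∧ 0 < z 2 ∧ z 2 ^ q * (z 1 * z 0) ^ p < 1 ∧
      (∀ j : Fin B, z 1 * z 0 ≤ z (Fin.castAdd d j).succ.succ.succ ∧
        z (Fin.castAdd d j).succ.succ.succ ≤ 1) ∧
      (fun l : Fin d => z (Fin.natAdd B l).succ.succ.succ) ∈ r.domain := by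
    intro z
    rw [hRd, hPd, elementaryDomain_eq p q B r]
    simp only [mem_setOf_eq, Fin.succ_zero_eq_one, Fin.succ_one_eq_two, Function.update_self,
      Function.update_of_ne h21, Function.update_of_ne (hk1 _)]
    constructor
    · rintro ⟨h0, h1, hs, hs1, -, -, hu, huq, ht, hw⟩
      exact ⟨h0, h1, hs, hs1, hu, huq, ht, hw⟩
    · rintro ⟨h0, h1, hs, hs1, hu, huq, ht, hw⟩
      exact ⟨h0, h1, hs, hs1, mul_pos hs h0, mul_lt_one_of_nonneg_of_lt_one_left hs.le hs1 h1.le,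
        hu, huq, ht, hw⟩
  have hpos : ∀ z ∈ R.domain, 0 < z 1 := fun z hz => ((hRmem z).mp hz).2.2.1
  -- the domain of `F` in coordinates
  set E : Set (Fin (B + d + 1 + 1 + 1) → ℝ) := {z | ∃ (σ s' v : ℝ) (t : Fin B → ℝ) (w : Fin d → ℝ),
    z = Matrix.vecCons σ (Matrix.vecCons s' (Matrix.vecCons v (Fin.append t w))) ∧ 0 < σ ∧ σ < 1 ∧
      0 < s' ∧ s' < 1 ∧ 0 < v ∧ v ^ q * σ ^ p < 1 ∧
      (∀ j, σ ^ (1 : ℕ) * s' ^ (1 : ℕ) ≤ t j ∧ t j ≤ 1) ∧ w ∈ r.domain} with hE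
  have hEmem : ∀ z : Fin (B + d + 1 + 1 + 1) → ℝ, z ∈ E ↔ 0 < z 0 ∧ z 0 < 1 ∧ 0 < z 1 ∧
      z 1 < 1 ∧ 0 < z 2 ∧ z 2 ^ q * z 0 ^ p < 1 ∧
      (∀ j : Fin B, z 0 * z 1 ≤ z (Fin.castAdd d j).succ.succ.succ ∧
        z (Fin.castAdd d j).succ.succ.succ ≤ 1) ∧
      (fun l : Fin d => z (Fin.natAdd B l).succ.succ.succ) ∈ r.domain :=
    Set.ext_iff.mp (hE.trans (blowupTypedDomain_eq q p B r))
  -- the rpow-shear maps `R.domain` onto `E`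
  have himg : (fun z : Fin (B + d + 1 + 1 + 1) → ℝ =>
      Function.update z 2 (z 2 * z 1 ^ ((p : ℝ) / q))) '' R.domain = E := by
    refine subset_antisymm (image_subset_iff.mpr fun z hz => ?_) fun y hy => ?_
    · obtain ⟨h0, h1, hs, hs1, hu, huq, ht, hw⟩ := (hRmem z).mp hz
      rw [mem_preimage, hEmem]
      simp only [Function.update_self, Function.update_of_ne h20.symm,
        Function.update_of_ne h21.symm, Function.update_of_ne (hk2 _)]
      refine ⟨h0, h1, hs, hs1, mul_pos hu (Real.rpow_pos_of_pos hs _), ?_,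
        fun j => by rw [mul_comm]; exact ht j, hw⟩
      rw [mul_pow, hpow hs, mul_assoc, ← mul_pow]
      exact huq
    · obtain ⟨h0, h1, hs, hs1, hv, hvq, ht, hw⟩ := (hEmem y).mp hy
      have hyk : 0 < y 1 ^ ((p : ℝ) / q) := Real.rpow_pos_of_pos hs _
      refine ⟨Function.update y 2 (y 2 * (y 1 ^ ((p : ℝ) / q))⁻¹), ?_, ?_⟩
      · rw [hRmem]
        simp only [Function.update_self, Function.update_of_ne h20.symm,
          Function.update_of_ne h21.symm, Function.update_of_ne (hk2 _)]
        refine ⟨h0, h1, hs, hs1, mul_pos hv (inv_pos.mpr hyk), ?_,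
          fun j => by rw [mul_comm]; exact ht j, hw⟩
        calc (y 2 * (y 1 ^ ((p : ℝ) / q))⁻¹) ^ q * (y 1 * y 0) ^ p
            = y 2 ^ q * y 0 ^ p * ((y 1 ^ p)⁻¹ * y 1 ^ p) := by
              rw [mul_pow, inv_pow, hpow hs, mul_pow]; ring
          _ = y 2 ^ q * y 0 ^ p := by rw [inv_mul_cancel₀ (pow_pos hs p).ne', mul_one]
          _ < 1 := hvq
      · dsimp only
        rw [Function.update_self, Function.update_of_ne h21.symm, Function.update_idem,
          inv_mul_cancel_right₀ hyk.ne', Function.update_eq_self]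
  -- the typed integrand is semialgebraic on `E`
  have hEsa : IsSemialgebraic ℚ E := himg ▸ IsSemialgebraicMapOn.isSemialgebraic_image_holds
    (isSemialgebraicMapOn_rpowShear 2 1 (p := p) hq R.isSemialgebraic_domain hpos) Subset.rfl
    R.isSemialgebraic_domain
  have hgsa : IsSemialgebraicFunOn ℚ E (fun z => z 1 ^ ((1 - (p : ℚ) / q : ℚ) : ℝ) *
      ((∏ j : Fin B, (z (Fin.castAdd d j).succ.succ.succ)⁻¹) *
        r.integrand (fun l : Fin d => z (Fin.natAdd B l).succ.succ.succ))) := by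
    refine (IsSemialgebraicFunOn.mul_holds
      (isSemialgebraicFunOn_rpow_coord_rat hEsa 1 (fun z hz => ((hEmem z).mp hz).2.2.1)
        (1 - (p : ℚ) / q))
      (IsSemialgebraicFunOn.mul_holds (isSemialgebraicFunOn_finset_prod' hEsa Finset.univ
        (fun (j : Fin B) (z : Fin (B + d + 1 + 1 + 1) → ℝ) =>
          (z (Fin.castAdd d j).succ.succ.succ)⁻¹)
        fun j _ => (isSemialgebraicFunOn_apply hEsa _).inv fun z hz => ?_)
      ((isSemialgebraicFunOn_comp_coords r.isSemialgebraicFunOn_integrand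
        (fun l : Fin d => (Fin.natAdd B l).succ.succ.succ)).mono
        (fun z hz => ((hEmem z).mp hz).2.2.2.2.2.2.2) hEsa))).congr fun z _ => ?_
    · obtain ⟨h0, -, hs, -, -, -, ht, -⟩ := (hEmem z).mp hz
      exact ((mul_pos h0 hs).trans_le (ht j).1).ne'
    · simp only [Pi.mul_apply]
  -- the integrand identity `s' · ∏ t_j⁻¹ · r(w) = (s' ^ (1 - p/q) · ∏ t_j⁻¹ · r(w)) · s' ^ (p/q)`
  have hexp : (((1 - (p : ℚ) / q : ℚ)) : ℝ) = 1 - (p : ℝ) / q := by push_cast; ring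
  have hfg : ∀ z ∈ R.domain, R.integrand z =
      (fun z : Fin (B + d + 1 + 1 + 1) → ℝ => z 1 ^ ((1 - (p : ℚ) / q : ℚ) : ℝ) *
        ((∏ j : Fin B, (z (Fin.castAdd d j).succ.succ.succ)⁻¹) *
          r.integrand (fun l : Fin d => z (Fin.natAdd B l).succ.succ.succ)))
        (Function.update z 2 (z 2 * z 1 ^ ((p : ℝ) / q))) * z 1 ^ ((p : ℝ) / q) := by
    intro z hz
    rw [hRi, hPi]
    simp only [Function.update_of_ne (hk1 _), Function.update_of_ne h21.symm,
      Function.update_of_ne (hk2 _)]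
    rw [hexp, mul_right_comm, ← Real.rpow_add (hpos z hz), sub_add_cancel, Real.rpow_one]
  obtain ⟨F, hFd, hFi, hrel⟩ := exists_rep_of_sub_mem_fibredRelations_rpowShear 2 1 h12 h20 hq
    R hpos himg _ hgsa hfg
  exact ⟨F, hFd, hFi, hrel⟩

end Summit.KontsevichZagierPeriods.ValuedFieldSpecialisation
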